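import Summits.CriticalPhenomena.SAWScalingLimit.Theorems.SAWCompassLatticeSurfaceUniversalityNonVacuity
import Literature.Probability.RandomPlanarGeometry.SelfAvoidingWalkProofs

/-!
# Non-vacuity of the PLUS side of the line `registered` for the crux `SurfaceUniversality`
# (stmt-CriticalPhenomena-6964): the critical plus-lattice law is a probability measure, eventually

Route `SAWCompassLattice` (sub-problem `SAWScalingLimit`). The lead's reshaped skeleton
(`Cruxes/SurfaceUniversality/Lines/birth.lean`) cuts the crux at the PLUS POINT of the port scaffold:
its two Lipschitz-level stubs `LipPlusPointIsZ2` (`SAW.law` vs the plus law) and `LipPlusToYB` (the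
plus law vs GM's `ybLaw (π/2)`) both integrate against the critical plus-lattice chordal law

  `PortGadget.pathLaw plusLattice (plusFugacity √x_c) (PortGadget.embed plusPos)
     (PortGadget.inFaces (meshFaces (π/2) Ω δ)) δ (inl a) (inl b)`

(self-avoiding port–centre–…–port paths of the plus lattice — one centre per face of the square
tiling wired to its four ports — whose centres are faces of `meshFaces (π/2) Ω δ`, weight
`(√x_c)^{#darts}`, normalised, pushed to `CurveClass ℂ`). This file proves that this law is a
PROBABILITY MEASURE for all small `δ > 0` under the hypotheses of the stubs (a Dobrushin domain and
a port endpoint approximation `IsYBEndpointApprox (π/2) D a b`), exactly as the landed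
`Surface.eventually_isProbabilityMeasure_compassLaw` does for the compass side: the junk value `0`
of `PortGadget.pathLaw` is eventually excluded, so neither stub is vacuous or junk-false (for
`f ≡ 1` both integrals are eventually `1`).

* `finite_plusPaths` — the admissible plus paths between two ports through a finite set of faces
  form a finite set (every port of such a path other than its start is a side of a visited face);
* `walkWeight_plusFugacity_pos` — weights are positive (`√x_c > 0`, from the unconditional
  `SAW.criticalFugacity_pos_lt_one'`);
* `nonempty_plusPaths_of_ybWalk` — a Yang–Baxter walk of `Δ` from `a` to `b` yields a self-avoiding
  plus path from port `a` to port `b` through centres of faces of `Δ` (consecutive mid-edges share a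
  face `f ∈ Δ`: port — centre of `f` — port; then `Walk.bypass`);
* `isProbabilityMeasure_plusLaw`, `eventually_isProbabilityMeasure_plusLaw` — the result.
-/

noncomputable section

namespace Summit.CriticalPhenomena.SAWScalingLimit.Theorems.SurfaceUniversality

open MeasureTheory Filter Topology Set
open Literature.Probability.RandomPlanarGeometry
open Literature.Probability.RandomPlanarGeometry.SAW
open Literature.Probability.RandomPlanarGeometry.SAW.YangBaxter
open Summit.CriticalPhenomena.SAWScalingLimit.Cruxes.HexTransfer.Sketch.Surface
  (meshFaces_rightAngles_finite exists_side_eq)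
open scoped ENNReal

/-! ### Finitely many plus paths through a finite set of faces -/

/-- On a plus walk, a port other than the starting vertex is entered from the centre of a face of
the walk: it is a side of a face carrying a vertex of the walk. -/
theorem plus_port_mem_of_mem_support {Δ : Set Face} {u w : MidEdge ⊕ Face × Unit}
    (p : plusLattice.Walk u w) (hS : ∀ v ∈ p.support, v ∈ PortGadget.inFaces Δ)
    {e : MidEdge} (he : (Sum.inl e : MidEdge ⊕ Face × Unit) ∈ p.support)
    (hne : (Sum.inl e : MidEdge ⊕ Face × Unit) ≠ u) :
    ∃ f ∈ Δ, ∃ s : Side, f.side s = e := by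
  rw [SimpleGraph.Walk.mem_support_iff] at he
  rcases he with he | he
  · exact absurd he hne
  rw [← SimpleGraph.Walk.map_snd_darts, List.mem_map] at he
  obtain ⟨d, hd, hde⟩ := he
  have hadj : plusLattice.Adj d.fst (Sum.inl e) := hde ▸ d.adj
  have hfst := hS _ (SimpleGraph.Walk.dart_fst_mem_support_of_mem_darts p hd)
  revert hadj hfst
  rcases d.fst with e' | ⟨f, q⟩
  · simp
  · intro hadj hfst
    rw [plusLattice_adj_inr_inl] at hadj
    obtain ⟨s, hs⟩ := hadj
    exact ⟨f, (PortGadget.inr_mem_inFaces Δ f q).1 hfst, s, hs⟩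

/-- **The self-avoiding plus paths between two ports through centres of a finite set of faces form
a finite set.** -/
theorem finite_plusPaths {Δ : Set Face} (hΔ : Δ.Finite) (a b : MidEdge) :
    Finite {p : plusLattice.Walk (Sum.inl a) (Sum.inl b) //
      p.IsPath ∧ ∀ v ∈ p.support, v ∈ PortGadget.inFaces Δ} := by
  classical
  let F : Set (MidEdge ⊕ Face × Unit) :=
    insert (Sum.inl a)
      (((fun q : Face × Side => Sum.inl (q.1.side q.2)) '' (Δ ×ˢ Set.univ)) ∪
        ((fun q : Face × Unit => Sum.inr q) '' (Δ ×ˢ Set.univ)))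
  have hF : F.Finite :=
    (((hΔ.prod (Set.toFinite _)).image _).union ((hΔ.prod (Set.toFinite _)).image _)).insert _
  haveI : Fintype F := hF.fintype
  have hsupp : ∀ p : {p : plusLattice.Walk (Sum.inl a) (Sum.inl b) //
      p.IsPath ∧ ∀ v ∈ p.support, v ∈ PortGadget.inFaces Δ},
      ∀ v ∈ p.1.support, v ∈ F := by
    rintro ⟨p, _, hS⟩ (e | ⟨f, q⟩) hv
    · by_cases h : (Sum.inl e : MidEdge ⊕ Face × Unit) = Sum.inl a
      · exact h ▸ Set.mem_insert _ _
      · obtain ⟨f, hf, s, hs⟩ := plus_port_mem_of_mem_support p hS hv h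
        exact Set.mem_insert_of_mem _ (Or.inl ⟨(f, s), ⟨hf, Set.mem_univ _⟩, by simp [hs]⟩)
    · exact Set.mem_insert_of_mem _ (Or.inr
        ⟨(f, q), ⟨(PortGadget.inr_mem_inFaces Δ f q).1 (hS _ hv), Set.mem_univ _⟩, rfl⟩)
  let g : {p : plusLattice.Walk (Sum.inl a) (Sum.inl b) //
      p.IsPath ∧ ∀ v ∈ p.support, v ∈ PortGadget.inFaces Δ} →
      {l : List F // l.length ≤ Fintype.card F} := fun p =>
    ⟨p.1.support.pmap (fun w hw => ⟨w, hw⟩) (hsupp p), by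
      rw [List.length_pmap]
      have hnd : (p.1.support.pmap (fun w hw => (⟨w, hw⟩ : F)) (hsupp p)).Nodup := by
        refine List.Nodup.pmap ?_ p.2.1.support_nodup
        intro a _ b _ h
        exact congrArg Subtype.val h
      have := hnd.length_le_card
      rwa [List.length_pmap] at this⟩
  haveI : Finite {l : List F // l.length ≤ Fintype.card F} :=
    (List.finite_length_le _ _).to_subtype
  refine Finite.of_injective g fun p p' h => ?_
  have h' := congrArg (fun l : {l : List F // l.length ≤ Fintype.card F} => l.1.map Subtype.val) h
  simp only [g, List.map_pmap, List.pmap_eq_map, List.map_id'] at h'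
  exact Subtype.ext (SimpleGraph.Walk.support_injective h')

/-! ### Positive weights -/

/-- Every plus walk has positive weight at a positive half-edge fugacity (`weight = p ^ length`). -/
theorem walkWeight_plusFugacity_pos {p : ℝ} (hp : 0 < p) {u v : MidEdge ⊕ Face × Unit}
    (w : plusLattice.Walk u v) : 0 < PortGadget.walkWeight (plusFugacity p) w := by
  rw [walkWeight_plusFugacity]
  exact pow_pos hp _

/-- The critical half-edge fugacity `√x_c` of the plus lattice is positive (`x_c = 1/μ > 0`,
unconditionally: `SAW.criticalFugacity_pos_lt_one'`). -/
theorem sqrt_criticalFugacity_pos : 0 < Real.sqrt SAW.criticalFugacity :=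
  Real.sqrt_pos.2 SAW.criticalFugacity_pos_lt_one'.1

/-! ### A Yang–Baxter walk yields a plus path -/

/-- A port on a side of a face of `Δ` is adjacent to the centre of that face (restricted plus
lattice). -/
theorem plus_adj_port_centre {Δ : Set Face} {f : Face} (hf : f ∈ Δ) {e : MidEdge} {s : Side}
    (hs : f.side s = e) :
    (plusLattice.induce (PortGadget.inFaces Δ)).Adj
      ⟨Sum.inl e, PortGadget.inl_mem_inFaces Δ e⟩
      ⟨Sum.inr (f, ()), (PortGadget.inr_mem_inFaces Δ f _).2 hf⟩ := by
  rw [SimpleGraph.induce_adj, plusLattice_adj_inl_inr]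
  exact ⟨s, hs⟩

/-- Two mid-edges with a common face in `Δ` are joined through the centre of that face. -/
theorem plus_reachable_of_commonFace {Δ : Set Face} {e e' : MidEdge} {f : Face} (hf : f ∈ Δ)
    (h : MidEdge.commonFace e e' = some f) :
    (plusLattice.induce (PortGadget.inFaces Δ)).Reachable
      ⟨Sum.inl e, PortGadget.inl_mem_inFaces Δ e⟩
      ⟨Sum.inl e', PortGadget.inl_mem_inFaces Δ e'⟩ := by
  obtain ⟨h1, h2⟩ := eq_faces_of_commonFace h
  obtain ⟨s, hs⟩ := exists_side_eq h1
  obtain ⟨s', hs'⟩ := exists_side_eq h2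
  exact (plus_adj_port_centre hf hs).reachable.trans (plus_adj_port_centre hf hs').reachable.symm

/-- The two ends of a chain of mid-edges whose consecutive pairs share faces of `Δ` are joined in
the restricted plus lattice. -/
theorem plus_reachable_of_arcs {Δ : Set Face} :
    ∀ (l : List MidEdge) (e e' : MidEdge), l.head? = some e → l.getLast? = some e' →
      (∀ p ∈ arcsOf l, ∃ f ∈ Δ, arcFace p = some f) →
        (plusLattice.induce (PortGadget.inFaces Δ)).Reachable
          ⟨Sum.inl e, PortGadget.inl_mem_inFaces Δ e⟩
          ⟨Sum.inl e', PortGadget.inl_mem_inFaces Δ e'⟩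
  | [], e, e', hh, _, _ => by simp at hh
  | [x], e, e', hh, hl, _ => by
    simp only [List.head?_cons, Option.some.injEq, List.getLast?_singleton] at hh hl
    subst hh hl
    rfl
  | x :: y :: l, e, e', hh, hl, harc => by
    simp only [List.head?_cons, Option.some.injEq] at hh
    subst hh
    have hxy : ∃ f ∈ Δ, arcFace (x, y) = some f := harc (x, y) (by simp [arcsOf])
    obtain ⟨f, hf, hfxy⟩ := hxy
    have ih := plus_reachable_of_arcs (y :: l) y e' rfl
      (by simpa [List.getLast?_cons_cons] using hl)
      (fun p hp => harc p (by
        simp only [arcsOf, List.tail_cons, List.zip_cons_cons, List.mem_cons] at hp ⊢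
        exact Or.inr hp))
    exact (plus_reachable_of_commonFace hf hfxy).trans ih

/-- **A Yang–Baxter walk of `Δ` from `a` to `b` yields a self-avoiding plus path from port `a` to
port `b` through centres of faces of `Δ`.** -/
theorem nonempty_plusPaths_of_ybWalk {Δ : Set Face} {a b : MidEdge} (γ : YBWalk Δ a b) :
    Nonempty {p : plusLattice.Walk (Sum.inl a) (Sum.inl b) //
      p.IsPath ∧ ∀ v ∈ p.support, v ∈ PortGadget.inFaces Δ} := by
  classical
  obtain ⟨q⟩ := plus_reachable_of_arcs γ.mids a b γ.head_eq γ.getLast_eq γ.arc_mem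
  let φ : plusLattice.induce (PortGadget.inFaces Δ) ↪g plusLattice :=
    SimpleGraph.Embedding.induce _
  have key : ∀ v ∈ (q.bypass.map φ.toHom).support, v ∈ PortGadget.inFaces Δ := by
    intro v hv
    rw [SimpleGraph.Walk.support_map, List.mem_map] at hv
    obtain ⟨w, -, rfl⟩ := hv
    exact w.2
  exact ⟨⟨q.bypass.map φ.toHom, q.bypass_isPath.map φ.injective, key⟩⟩

/-! ### The plus law is a probability measure -/

/-- The total mass of the plus path measure is the sum of the weights of the admissible paths. -/
theorem plusMeasure_univ (p : ℝ) (Δ : Set Face) (δ : ℝ) (a b : MidEdge) :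
    PortGadget.pathMeasure plusLattice (plusFugacity p) (PortGadget.embed plusPos)
        (PortGadget.inFaces Δ) δ (Sum.inl a) (Sum.inl b) Set.univ =
      ∑' q : {q : plusLattice.Walk (Sum.inl a) (Sum.inl b) //
        q.IsPath ∧ ∀ v ∈ q.support, v ∈ PortGadget.inFaces Δ},
        ENNReal.ofReal (PortGadget.walkWeight (plusFugacity p) q.1) := by
  rw [PortGadget.pathMeasure, Measure.sum_apply _ MeasurableSet.univ]
  simp

/-- **The plus law through a finite set of faces is a probability measure** as soon as the
half-edge fugacity is positive and some Yang–Baxter walk of `Δ` joins `a` to `b` (any mesh `δ`,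
which only enters the drawing): the partition function is positive (a plus path exists, all
weights are positive) and finite (finitely many paths). -/
theorem isProbabilityMeasure_plusLaw_of_finite {p : ℝ} (hp : 0 < p) {Δ : Set Face}
    (hΔ : Δ.Finite) (δ : ℝ) {a b : MidEdge} (hne : Nonempty (YBWalk Δ a b)) :
    IsProbabilityMeasure (PortGadget.pathLaw plusLattice (plusFugacity p) (PortGadget.embed plusPos)
      (PortGadget.inFaces Δ) δ (Sum.inl a) (Sum.inl b)) := by
  classical
  haveI hfin : Finite {q : plusLattice.Walk (Sum.inl a) (Sum.inl b) //
      q.IsPath ∧ ∀ v ∈ q.support, v ∈ PortGadget.inFaces Δ} := finite_plusPaths hΔ a b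
  haveI : Fintype {q : plusLattice.Walk (Sum.inl a) (Sum.inl b) //
      q.IsPath ∧ ∀ v ∈ q.support, v ∈ PortGadget.inFaces Δ} := Fintype.ofFinite _
  obtain ⟨γ⟩ := hne
  obtain ⟨q⟩ := nonempty_plusPaths_of_ybWalk γ
  have h0 : PortGadget.pathMeasure plusLattice (plusFugacity p) (PortGadget.embed plusPos)
      (PortGadget.inFaces Δ) δ (Sum.inl a) (Sum.inl b) Set.univ ≠ 0 := by
    rw [plusMeasure_univ]
    refine fun h => ?_
    have hq := ENNReal.le_tsum (f := fun q : {q : plusLattice.Walk (Sum.inl a) (Sum.inl b) //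
        q.IsPath ∧ ∀ v ∈ q.support, v ∈ PortGadget.inFaces Δ} =>
      ENNReal.ofReal (PortGadget.walkWeight (plusFugacity p) q.1)) q
    rw [h, nonpos_iff_eq_zero, ENNReal.ofReal_eq_zero] at hq
    exact absurd hq (not_le.2 (walkWeight_plusFugacity_pos hp q.1))
  have htop : PortGadget.pathMeasure plusLattice (plusFugacity p) (PortGadget.embed plusPos)
      (PortGadget.inFaces Δ) δ (Sum.inl a) (Sum.inl b) Set.univ ≠ ⊤ := by
    rw [plusMeasure_univ, tsum_fintype]
    exact ENNReal.sum_ne_top.2 fun _ _ => ENNReal.ofReal_ne_top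
  refine ⟨?_⟩
  change (PortGadget.pathMeasure plusLattice (plusFugacity p) (PortGadget.embed plusPos)
      (PortGadget.inFaces Δ) δ (Sum.inl a) (Sum.inl b) Set.univ)⁻¹ •
    PortGadget.pathMeasure plusLattice (plusFugacity p) (PortGadget.embed plusPos)
      (PortGadget.inFaces Δ) δ (Sum.inl a) (Sum.inl b) Set.univ = 1
  rw [smul_eq_mul, ENNReal.inv_mul_cancel h0 htop]

/-- **The critical plus law of a bounded domain is a probability measure** as soon as `δ > 0` and
some Yang–Baxter walk of `Ω_δ` (square tiling) joins `a` to `b`. -/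
theorem isProbabilityMeasure_plusLaw {Ω : Set ℂ} (hΩ : Bornology.IsBounded Ω) {δ : ℝ}
    (hδ : 0 < δ) {a b : MidEdge} (hne : Nonempty (YangBaxterSAW rightAngles Ω δ a b)) :
    IsProbabilityMeasure (PortGadget.pathLaw plusLattice
      (plusFugacity (Real.sqrt SAW.criticalFugacity)) (PortGadget.embed plusPos)
      (PortGadget.inFaces (meshFaces rightAngles Ω δ)) δ (Sum.inl a) (Sum.inl b)) :=
  isProbabilityMeasure_plusLaw_of_finite sqrt_criticalFugacity_pos
    (meshFaces_rightAngles_finite hΩ hδ) δ hne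

/-- **Non-vacuity of the plus side of the line.** For a Dobrushin domain `D` and a port endpoint
approximation `(a, b)` at `Θ ≡ π/2`, the critical plus-lattice chordal law
`PortGadget.pathLaw plusLattice (plusFugacity √x_c) … δ (inl (a δ)) (inl (b δ))` — the `plusLaw` of
the lead's skeleton, integrated against in both Lipschitz stubs `LipPlusPointIsZ2`, `LipPlusToYB` —
is a probability measure for all small `δ > 0`; in particular its junk value `0` is eventually
excluded. -/
theorem eventually_isProbabilityMeasure_plusLaw (D : DobrushinDomain) {a b : ℝ → MidEdge}
    (h : IsYBEndpointApprox rightAngles D a b) :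
    ∀ᶠ δ in 𝓝[>] (0 : ℝ),
      IsProbabilityMeasure (PortGadget.pathLaw plusLattice
        (plusFugacity (Real.sqrt SAW.criticalFugacity)) (PortGadget.embed plusPos)
        (PortGadget.inFaces (meshFaces rightAngles D.carrier δ)) δ (Sum.inl (a δ)) (Sum.inl (b δ))) := by
  filter_upwards [h.nonempty, self_mem_nhdsWithin] with δ hne hδ
  exact isProbabilityMeasure_plusLaw D.isBounded hδ hne

/-- Registered groundwork stub `plusNonVacuity` of the crux (one-line signature): the plus law of
the line's stubs is a probability measure for all small `δ > 0` under a port endpoint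
approximation. -/
theorem plusNonVacuity : ∀ (D : DobrushinDomain) (a b : ℝ → MidEdge), IsYBEndpointApprox rightAngles D a b → ∀ᶠ δ in 𝓝[>] (0 : ℝ), IsProbabilityMeasure (PortGadget.pathLaw plusLattice (plusFugacity (Real.sqrt SAW.criticalFugacity)) (PortGadget.embed plusPos) (PortGadget.inFaces (meshFaces rightAngles D.carrier δ)) δ (Sum.inl (a δ)) (Sum.inl (b δ))) :=
  fun D _ _ h => eventually_isProbabilityMeasure_plusLaw D h

end Summit.CriticalPhenomena.SAWScalingLimit.Theorems.SurfaceUniversality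

end
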